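import Literature.AnabelianGeometry.AbsoluteAnabelian.AbsTopIII.MLFGaloisModelCategories
import Literature.AnabelianGeometry.AbsoluteAnabelian.MLFGaloisPairsWitness
import Mathlib.FieldTheory.AbsoluteGaloisGroup
import HarnessLib

/-!
# [AbsTopIII] Def 3.1 (iii) — NON-VACUITY of the double-underlined `𝒯𝔾`-objects `AbsTopIII.TopGroupObj` (+ `Hom`)
# (rows «NV-L4/AbsTopIII.TopGroupObj», «NV-L4/AbsTopIII.TopGroupObj.Hom»)

Mochizuki, *Topics in Absolute Anabelian Geometry III*, Def 3.1 (iii) p. 68 ("the category `𝒯𝔾` of topological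
groups … the various subcategories determined by the isomorphisms"); typed by abc-iut-L4-t2 in
`AbsTopIII/MLFGaloisModelCategories.lean` as the bundled `TopGroupObj = (G, Group, TopologicalSpace,
IsTopologicalGroup)` with `Hom A B = (iso : A.G ≃ₜ* B.G)`. PROOF-ONLY companion (no `def`, no `instance`, no
`structure`). abc-iut-w5-d197's INHABITATION CENSUS L4 v1 (§A) lists `TopGroupObj` and `TopGroupObj.Hom` with ZERO
producers. The witnesses are the GENUINE objects of the theory:

* `TopGroupObj.exists_absoluteGaloisGroup` — for every field `K`, the absolute Galois group `G_K` with the Krull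
  topology (Mathlib `Field.absoluteGaloisGroup`) is an object of `𝒯𝔾`; closed term `exists_padicGalois` at
  `K := ℚ_p`; `exists_modelPi` — so is `Π_k` of any model datum (abc-iut-L4-t2's `ModelMLFGaloisData`);
* `TopGroupObj.nonempty_hom_self` / `nonempty_iso_self` — `Hom` (and `≅`) is inhabited at every object by the
  identity `ContinuousMulEquiv.refl`; `nonempty_hom_iff` — in general `Hom A B` is inhabited iff `A.G ≃ₜ* B.G` is.

Nothing of [AbsTopIII] is asserted; a witness is consistency evidence only.
[cite: MochizukiAbsTopIII2015, Definition 3.1 (iii) p.68]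
-/

noncomputable section

namespace Literature.AnabelianGeometry.AbsoluteAnabelian.AbsTopIII

open CategoryTheory

namespace TopGroupObj

/-- **AbsTopIII:Def3.1(iii)** (kurims p.68) GENUINE: for every field `K`, the absolute Galois group `G_K` (Krull
topology) is an object of the double-underlined `𝒯𝔾`. [cite: MochizukiAbsTopIII2015, Definition 3.1 (iii) p.68] -/
theorem exists_absoluteGaloisGroup (K : Type) [Field K] :
    ∃ A : TopGroupObj, A.G = Field.absoluteGaloisGroup K :=
  ⟨{ G := Field.absoluteGaloisGroup K }, rfl⟩

/-- **AbsTopIII:Def3.1(iii)** (kurims p.68) Closed term: `G_{ℚ_p}` is an object of `𝒯𝔾`, for every prime `p`.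
[cite: MochizukiAbsTopIII2015, Definition 3.1 (iii) p.68] -/
theorem exists_padicGalois (p : ℕ) [Fact p.Prime] :
    ∃ A : TopGroupObj, A.G = Field.absoluteGaloisGroup ℚ_[p] :=
  exists_absoluteGaloisGroup ℚ_[p]

/-- **AbsTopIII:Def3.1(iii)** (kurims p.68) GENUINE: the group `Π_k` of any model datum `(Π_k ↠ G_k)` (abc-iut-L4-t2's
`ModelMLFGaloisData` over an `MLFClosure`) is an object of `𝒯𝔾`. [cite: MochizukiAbsTopIII2015, Definition 3.1 (i) p.66] -/
theorem exists_modelPi (C : MLFClosure.{0}) (D : ModelMLFGaloisData C.k C.K) :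
    ∃ A : TopGroupObj, A.G = D.Pi :=
  ⟨{ G := D.Pi }, rfl⟩

/-- **AbsTopIII:Def3.1(iii)** (kurims p.68) The interface `TopGroupObj` is inhabited (closed term: `G_{ℚ_2}`).
[cite: MochizukiAbsTopIII2015, Definition 3.1 (iii) p.68] -/
theorem nonempty_model : Nonempty TopGroupObj :=
  ⟨{ G := Field.absoluteGaloisGroup ℚ_[2] }⟩

/-- **AbsTopIII:Def3.1(iii)** (kurims p.68) `Hom A A` is inhabited by the identity isomorphism of topological groups
(the identity morphism `𝟙 A` of the landed category instance). [cite: MochizukiAbsTopIII2015, Definition 3.1 (iii) p.68] -/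
theorem nonempty_hom_self (A : TopGroupObj) : Nonempty (Hom A A) := ⟨𝟙 A⟩

/-- **AbsTopIII:Def3.1(iii)** (kurims p.68) EXACT CRITERION: `Hom A B` is inhabited iff there is an isomorphism of
topological groups `A.G ≃ₜ* B.G` (the record has that one field). [cite: MochizukiAbsTopIII2015, Definition 3.1 (iii) p.68] -/
theorem nonempty_hom_iff (A B : TopGroupObj) : Nonempty (Hom A B) ↔ Nonempty (A.G ≃ₜ* B.G) :=
  ⟨fun ⟨f⟩ => ⟨f.iso⟩, fun ⟨e⟩ => ⟨⟨e⟩⟩⟩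

/-- **AbsTopIII:Def3.1(iii)** (kurims p.68) Every object is isomorphic to itself in the landed category structure
(`isoOfHom` of the identity). [cite: MochizukiAbsTopIII2015, Definition 3.1 (iii) p.68] -/
theorem nonempty_iso_self (A : TopGroupObj) : Nonempty (A ≅ A) := ⟨isoOfHom (𝟙 A)⟩

/-- **AbsTopIII:Def3.1(iii)** (kurims p.68) Closed term for the `Hom` row: the identity of the `𝒯𝔾`-object `G_{ℚ_2}`.
[cite: MochizukiAbsTopIII2015, Definition 3.1 (iii) p.68] -/
theorem exists_hom : ∃ A : TopGroupObj, Nonempty (Hom A A) :=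
  ⟨{ G := Field.absoluteGaloisGroup ℚ_[2] }, nonempty_hom_self _⟩

end TopGroupObj

end Literature.AnabelianGeometry.AbsoluteAnabelian.AbsTopIII

end
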